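import Summits.Ventures.PackingBounds.Energy.FivePointCkTwoUnique
import Summits.Ventures.PackingBounds.Energy.FivePointCkTwoOptimal
import Summits.Ventures.PackingBounds.Energy.FivePointBipyramidIsometry
import HarnessLib

/-!
# Five points on `S²`, potential `(1+⟪x,y⟫)²`: the ground state is unique up to isometry

Framing: lottery ticket; floor = certified bounds/negative ranges. Venture `PackingBounds`, cell
`pub-packcert`, energy family E3PT (pub-packcert-energy gen 12).

Assembly of `ck2_five_points`, the SOS-face rigidity `ck2_five_points_rigid` and `Bipyramid5.isometric`:
every minimiser of `Σ_{x≠y} (1+⟪x,y⟫)²` among five points of `S²` is the image of `Config.Bipyramid.pts` under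
a linear isometry of `ℝ³`; any two minimisers are isometric.
-/

noncomputable section

open Finset
open scoped RealInnerProductSpace

namespace Summit.Ventures.PackingBounds.Energy

open Summit.Ventures.PackingBounds.Config

/-- **`(1+t)²`-energy of five points, uniqueness:** any two minimisers (`Σ_{x≠y} (1+⟪x,y⟫)² = 27/2`) are related
by a linear isometry of `ℝ³`. -/
theorem FivePointCkTwo.minimisers_isometric (C C' : Finset (EuclideanSpace ℝ (Fin 3)))
    (hC : ∀ x ∈ C, ‖x‖ = 1) (h5 : C.card = 5)
    (hmin : ∑ x ∈ C, ∑ y ∈ C.erase x, (1 + inner ℝ x y) ^ 2 = 27 / 2)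
    (hC' : ∀ x ∈ C', ‖x‖ = 1) (h5' : C'.card = 5)
    (hmin' : ∑ x ∈ C', ∑ y ∈ C'.erase x, (1 + inner ℝ x y) ^ 2 = 27 / 2) :
    ∃ Ψ : EuclideanSpace ℝ (Fin 3) ≃ₗᵢ[ℝ] EuclideanSpace ℝ (Fin 3), C' = C.image Ψ :=
  Bipyramid5.isometric C C' hC h5 (FivePointCkTwo.ck2_five_points_rigid C hC h5 hmin).2.2
    hC' h5' (FivePointCkTwo.ck2_five_points_rigid C' hC' h5' hmin').2.2

/-- **`(1+t)²`-energy of five points, the ground state:** every minimiser is the image of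
`Config.Bipyramid.pts` under a linear isometry of `ℝ³`. -/
theorem FivePointCkTwo.ground_state_unique (C : Finset (EuclideanSpace ℝ (Fin 3)))
    (hC : ∀ x ∈ C, ‖x‖ = 1) (h5 : C.card = 5)
    (hmin : ∑ x ∈ C, ∑ y ∈ C.erase x, (1 + inner ℝ x y) ^ 2 = 27 / 2) :
    ∃ Ψ : EuclideanSpace ℝ (Fin 3) ≃ₗᵢ[ℝ] EuclideanSpace ℝ (Fin 3), C = Bipyramid.pts.image Ψ :=
  FivePointCkTwo.minimisers_isometric Bipyramid.pts C Bipyramid.norm_pts Bipyramid.card_pts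
    FivePointCkTwo.bipyramid_ck2_energy hC h5 hmin

end Summit.Ventures.PackingBounds.Energy
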